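import Summits.Parity.GeneralizedHardyLittlewood.Theorems.PrimeLevelFamEdgeMomentsBeyondDiagonalLayersClassUniformScalars
import Summits.Parity.GeneralizedHardyLittlewood.Theorems.PrimeLevelFamEdgeMomentsBeyondDiagonalLayersClassBoundAll
import Summits.Parity.GeneralizedHardyLittlewood.Theorems.PrimeLevelFamEdgeMomentsBeyondDiagonalLayersClassBoundFourier
import Summits.Parity.GeneralizedHardyLittlewood.Theorems.PrimeLevelFamEdgeMomentsBeyondDiagonalLayersClassRanges
import HarnessLib

/-!
# Route `PrimeLevelFamEdge`, crux K_A `MomentsBeyondDiagonal` (stmt-Parity-20007), line «petersson_layers» v4: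
# the UNIFORM PER-CLASS BOUND of `stub_farP`'s `k = 0` forms (assembly step E5b, CONDITIONAL on Pascadi's Thm 7.1)

For one block `(d₁,d₂)` and one class `(s₁,t₁,s₂,t₂)` of `…LayersClassReduction.subFar_rhoP_of_classSum_bound` (class factor
`φ(qr)/φ(qr/g)` included, `Y = ⌈x^{2+η}⌉`, `x = q̂`), on the window `q ≥ 64` prime, `x^{11/10} < r`, `1 < Δ' ≤ 101/100`, `0 ≤ η ≤ 1/100`:
**`classTerm_le_uniform`**:
`(φ(qr)/φ(qr/g))·‖class form‖ ≤ C · (√D₁√D₂B²KL·√(1+2log q)) · x^{Δ'+1+η/2−13/600} · (qr)^{1+ε} · (d₁d₂)⁻¹ · (s₁t₁s₂t₂)^{−1/12}`,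
by the regime dispatch of the census (CENSUS-leafhand2-g2 on the crux item): empty flat box or empty hyperbola ⇒ `0`
(`…LayersClassFacts`); `t₁ ≤ x^{1/5}` ⇒ `q ∤ s₁t₁`, `σ₁'Z₁Z₂ ≤ qr/g`, and Pascadi's Theorem 7.1 in the ordering decided by
`σ₂'V ≶ σ₁'Z₁Z₂` (`…LayersClassBoundAll`, brackets by `…LayersClassLengths/Generic(B)`, weights by `…pascadi_weight_le`);
`t₁ > x^{1/5}` ⇒ the dilated Parseval floor (`…LayersClassBoundFourier`, multiplicities `m₁ ≤ x^{2Δ'}P/(qr)`, `m₂ ≤ 1`, weights by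
`…fourier_weight_le`).  Remaining (census E7): the class and block sums and the instantiation of
`subFar_rhoP_of_classSum_bound`; NOT done here.  Proof only (def-free, CONDITIONAL helper: the named fact is a HYPOTHESIS); K_A NOT
proved; nothing of Pascadi's proof is formalised; nothing about Landau–Siegel zeros.
-/

noncomputable section

open scoped Real Nat
open Complex Finset Polynomial MeasureTheory
open Literature.NumberTheory.LFunctions

namespace Summit.Parity.GeneralizedHardyLittlewood.Theorems.MomentsBeyondDiagonal.Layers

open Summit.Parity.GeneralizedHardyLittlewood.Theorems.PrimeLevelFamEdgeIdeaDeltas.PeterssonLayers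

/-- **The uniform per-class bound** (CONDITIONAL on `pascadi2025_theorem71`; see the module docstring).
[cite: Pascadi2025, Thm. 7.1 (case c = q·(r/g), a = 1)] -/
theorem classTerm_le_uniform (h : pascadi2025_theorem71) {ε : ℝ} (hε : 0 < ε) :
    ∃ C : ℝ, 0 ≤ C ∧ ∀ (q : ℕ) [NeZero q], 64 ≤ q → q.Prime → ∀ (r : ℕ), KMV2000.qhat q ^ (11 / 10 : ℝ) < r →
      ∀ (P : ℝ[X]) (B : ℝ), (∀ t ∈ Set.Icc (0 : ℝ) 1, |P.eval t| ≤ B) → ∀ (Δ' : ℝ), 1 < Δ' → Δ' ≤ 101 / 100 →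
      ∀ (η : ℝ), 0 ≤ η → η ≤ 1 / 100 →
      ∀ (i j : ℕ) (K : ℝ), 0 ≤ K →
        (∀ {N₁ N₂ : ℕ}, N₁ ∈ afeBox q → N₂ ∈ afeBox q →
          ‖((((N₁ : ℝ) * N₂) ^ (-(1 / 2 : ℝ)) : ℝ) : ℂ) * afeW (KMV2000.qhat q) i j N₁ N₂‖ *
              Real.sqrt ((N₁ : ℝ) * N₂) ≤
            K * ((1 + Real.log (KMV2000.qhat q)) * (1 + 2 * Real.log q)) ^ (i + j) *
              (KMV2000.qhat q ^ 2 / ((N₁ : ℝ) * N₂)) ^ (0 : ℝ)) →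
      ∀ (D₁ D₂ : ℝ), 0 ≤ D₁ → 0 ≤ D₂ →
        (∀ u ∈ Icc 1 (⌊KMV2000.qhat q ^ Δ'⌋₊ * ⌊KMV2000.qhat q ^ Δ'⌋₊), (#u.divisors : ℝ) ≤ D₁) →
        (∀ v ∈ Icc 1 (q ^ 2 * q ^ 2), (#v.divisors : ℝ) ≤ D₂) →
      ∀ (d₁ d₂ s₁ t₁ s₂ t₂ g : ℕ) [NeZero (q * r / g)],
        d₁ ∈ Icc 1 ⌊KMV2000.qhat q ^ Δ'⌋₊ → d₂ ∈ Icc 1 ⌊KMV2000.qhat q ^ Δ'⌋₊ →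
        s₁ ∈ Icc 1 (⌊KMV2000.qhat q ^ Δ'⌋₊ / d₁) → t₁ ∈ Icc 1 (q ^ 2 / d₁) →
        s₂ ∈ Icc 1 (⌊KMV2000.qhat q ^ Δ'⌋₊ / d₂) → t₂ ∈ Icc 1 (q ^ 2 / d₂) →
        g = Nat.gcd (Nat.gcd (s₁ * t₁) (s₂ * t₂)) (q * r) →
        (((q * r).totient : ℝ) / (((q * r) / g).totient : ℝ)) *
        ‖∑ f₁ ∈ Icc 1 (⌊KMV2000.qhat q ^ Δ'⌋₊ / d₁ / s₁), ∑ h₁ ∈ Icc 1 (q ^ 2 / d₁ / t₁),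
          ∑ f₂ ∈ Icc 1 (⌊KMV2000.qhat q ^ Δ'⌋₊ / d₂ / s₂), ∑ h₂ ∈ Icc 1 (q ^ 2 / d₂ / t₂),
            (if Nat.Coprime f₁ (q * r) ∧ Nat.Coprime f₂ (q * r) then
                (KMV2000.mollifierCoeff P (KMV2000.qhat q ^ Δ') (d₁ * (s₁ * f₁)) : ℂ) *
                  (KMV2000.mollifierCoeff P (KMV2000.qhat q ^ Δ') (d₂ * (s₂ * f₂)) : ℂ) *
                  ((Real.sqrt ((s₁ * f₁ : ℕ) : ℝ) * Real.sqrt ((s₂ * f₂ : ℕ) : ℝ) : ℝ) : ℂ) else 0) *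
              (if Nat.Coprime h₁ (q * r) ∧ Nat.Coprime h₂ (q * r) then
                  (if d₁ * (t₁ * h₁) * (d₂ * (t₂ * h₂)) ≤ ⌈KMV2000.qhat q ^ (2 + η)⌉₊ then
                      ((((((d₁ * (t₁ * h₁) : ℕ) : ℝ) * ((d₂ * (t₂ * h₂) : ℕ) : ℝ)) ^ (-(1 / 2 : ℝ)) : ℝ) : ℂ) *
                        afeW (KMV2000.qhat q) i j (d₁ * (t₁ * h₁)) (d₂ * (t₂ * h₂))) else 0) *
                    ((Real.sqrt ((t₁ * h₁ : ℕ) : ℝ) * Real.sqrt ((t₂ * h₂ : ℕ) : ℝ) : ℝ) : ℂ) else 0) *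
              kloostermanSum (q * r / g) ((s₁ * t₁ / g * (f₁ * f₂) : ℕ) : ZMod (q * r / g))
                ((s₂ * t₂ / g * (h₁ * h₂) : ℕ) : ZMod (q * r / g))‖ ≤
          C * (Real.sqrt D₁ * Real.sqrt D₂ * B ^ 2 * K * ((1 + Real.log (KMV2000.qhat q)) * (1 + 2 * Real.log q)) ^ (i + j) *
              Real.sqrt (1 + 2 * Real.log q)) *
            KMV2000.qhat q ^ (Δ' + 1 + η / 2 - 13 / 600) * ((q : ℝ) * r) ^ (1 + ε) / ((d₁ : ℝ) * d₂) *
            (((s₁ * t₁ * (s₂ * t₂) : ℕ) : ℝ)) ^ (-(1 / 12 : ℝ)) := by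
  obtain ⟨CA, hCA0, hA⟩ := norm_classForm_le_of_pascadi_all h hε
  obtain ⟨CB, hCB0, hB'⟩ := norm_classForm_le_of_pascadi_all' h hε
  refine ⟨6 * (CA + CB) + 4, by positivity, ?_⟩
  intro q _ h64 hq r hr P B hB Δ' hΔ1 hΔ2 η hη0 hη1 i j K hK0 hK D₁ D₂ hD₁0 hD₂0 hD₁ hD₂
    d₁ d₂ s₁ t₁ s₂ t₂ g _ hd₁ hd₂ hs₁ ht₁ hs₂ ht₂ hg
  -- §0 scalars and ranges
  have hqh1 : 1 < KMV2000.qhat q := one_lt_qhat h64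
  have hqh0 : 0 < KMV2000.qhat q := zero_lt_one.trans hqh1
  have hΔ0 : 0 < Δ' := by linarith
  obtain ⟨hd₁1, hd₁M⟩ := mem_Icc.mp hd₁
  obtain ⟨hd₂1, hd₂M⟩ := mem_Icc.mp hd₂
  obtain ⟨hs₁1, hs₁M⟩ := mem_Icc.mp hs₁
  obtain ⟨ht₁1, ht₁M⟩ := mem_Icc.mp ht₁
  obtain ⟨hs₂1, hs₂M⟩ := mem_Icc.mp hs₂
  obtain ⟨ht₂1, ht₂M⟩ := mem_Icc.mp ht₂
  have hqr0 : q * r ≠ 0 := fun h0 ↦ NeZero.ne (q * r / g) (by rw [h0, Nat.zero_div])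
  have hr1 : 1 ≤ r := Nat.one_le_iff_ne_zero.mpr fun h0 ↦ hqr0 (by rw [h0, mul_zero])
  have hq1 : 1 ≤ q := le_trans (by norm_num) h64
  have hgpos : 0 < g := by rw [hg]; exact Nat.pos_of_ne_zero (Nat.gcd_ne_zero_right hqr0)
  have hgσ₁ : g ∣ s₁ * t₁ := by rw [hg]; exact (classGcd_dvd (s₁ * t₁) (s₂ * t₂) (q * r)).1
  have hgσ₂ : g ∣ s₂ * t₂ := by rw [hg]; exact (classGcd_dvd (s₁ * t₁) (s₂ * t₂) (q * r)).2.1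
  have hgc : g ∣ q * r := by rw [hg]; exact (classGcd_dvd (s₁ * t₁) (s₂ * t₂) (q * r)).2.2.1
  have hs₁M' : s₁ ≤ ⌊KMV2000.qhat q ^ Δ'⌋₊ := hs₁M.trans (Nat.div_le_self _ _)
  have hs₂M' : s₂ ≤ ⌊KMV2000.qhat q ^ Δ'⌋₊ := hs₂M.trans (Nat.div_le_self _ _)
  have hMx : ((⌊KMV2000.qhat q ^ Δ'⌋₊ : ℕ) : ℝ) ≤ KMV2000.qhat q ^ (101 / 100 : ℝ) :=
    (Nat.floor_le (Real.rpow_nonneg hqh0.le _)).trans (Real.rpow_le_rpow_of_exponent_le hqh1.le hΔ2)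
  have hs₁x : (s₁ : ℝ) ≤ KMV2000.qhat q ^ (101 / 100 : ℝ) := le_trans (by exact_mod_cast hs₁M') hMx
  have hs₂x : (s₂ : ℝ) ≤ KMV2000.qhat q ^ (101 / 100 : ℝ) := le_trans (by exact_mod_cast hs₂M') hMx
  have hlq : 0 ≤ Real.log (q : ℝ) := Real.log_nonneg (by exact_mod_cast hq1)
  have hlog : 0 ≤ 1 + 2 * Real.log q := by linarith
  have hL0 : 0 ≤ ((1 + Real.log (KMV2000.qhat q)) * (1 + 2 * Real.log q)) ^ (i + j) :=
    pow_nonneg (mul_nonneg (by linarith [Real.log_nonneg hqh1.le]) hlog) _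
  have hB0 : 0 ≤ B := le_trans (abs_nonneg _) (hB 0 (by simp))
  set Φ : ℝ := Real.sqrt D₁ * Real.sqrt D₂ * B ^ 2 * K * ((1 + Real.log (KMV2000.qhat q)) * (1 + 2 * Real.log q)) ^ (i + j)
    with hΦ
  have hΦ0 : 0 ≤ Φ := by rw [hΦ]; positivity
  set P₀ : ℝ := (((s₁ * t₁ * (s₂ * t₂) : ℕ) : ℝ)) with hP₀
  have hP₀1 : 1 ≤ P₀ := by rw [hP₀]; exact_mod_cast Nat.one_le_iff_ne_zero.mpr (by positivity)
  have hP₀0 : 0 < P₀ := by linarith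
  set T : ℝ := Φ * Real.sqrt (1 + 2 * Real.log q) * KMV2000.qhat q ^ (Δ' + 1 + η / 2 - 13 / 600) *
    ((q : ℝ) * r) ^ (1 + ε) / ((d₁ : ℝ) * d₂) * P₀ ^ (-(1 / 12 : ℝ)) with hT
  have hT0 : 0 ≤ T := by rw [hT]; positivity
  have hRHS : (6 * (CA + CB) + 4) * (Φ * Real.sqrt (1 + 2 * Real.log q)) *
      KMV2000.qhat q ^ (Δ' + 1 + η / 2 - 13 / 600) * ((q : ℝ) * r) ^ (1 + ε) / ((d₁ : ℝ) * d₂) * P₀ ^ (-(1 / 12 : ℝ)) =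
      (6 * (CA + CB) + 4) * T := by rw [hT]; ring
  rw [hRHS]
  have hRHS0 : 0 ≤ (6 * (CA + CB) + 4) * T := by positivity
  -- the class factor
  have hφ : (((q * r).totient : ℕ) : ℝ) / ((((q * r) / g).totient : ℕ) : ℝ) ≤ g := totient_div_le_classGcd hqr0 hgc
  have hφ0 : 0 ≤ (((q * r).totient : ℕ) : ℝ) / ((((q * r) / g).totient : ℕ) : ℝ) := by positivity
  -- §1 empty flat boxes
  rcases Nat.eq_zero_or_pos (⌊KMV2000.qhat q ^ Δ'⌋₊ / d₁ / s₁) with hZ₁ | hZ₁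
  · rw [hZ₁, Finset.Icc_eq_empty_of_lt zero_lt_one, sum_empty, norm_zero, mul_zero]; exact hRHS0
  rcases Nat.eq_zero_or_pos (⌊KMV2000.qhat q ^ Δ'⌋₊ / d₂ / s₂) with hZ₂ | hZ₂
  · rw [hZ₂, Finset.Icc_eq_empty_of_lt zero_lt_one]
    simp only [sum_empty, sum_const_zero, norm_zero, mul_zero]; exact hRHS0
  -- §2 empty hyperbola
  have hD : 0 < d₁ * t₁ * (d₂ * t₂) := by positivity
  rcases Nat.eq_zero_or_pos (⌈KMV2000.qhat q ^ (2 + η)⌉₊ / (d₁ * t₁ * (d₂ * t₂))) with hV | hV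
  · have h0 := classForm_eq_zero_of_hyperbola_empty hD hV
      (fun N₁ N₂ ↦ ((((N₁ : ℝ) * (N₂ : ℝ)) ^ (-(1 / 2 : ℝ)) : ℝ) : ℂ) * afeW (KMV2000.qhat q) i j N₁ N₂) (q * r)
      (fun n₁ n₂ ↦ ((Real.sqrt ((t₁ * n₁ : ℕ) : ℝ) * Real.sqrt ((t₂ * n₂ : ℕ) : ℝ) : ℝ) : ℂ))
      (fun f₁ f₂ ↦ (if Nat.Coprime f₁ (q * r) ∧ Nat.Coprime f₂ (q * r) then
          (KMV2000.mollifierCoeff P (KMV2000.qhat q ^ Δ') (d₁ * (s₁ * f₁)) : ℂ) *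
            (KMV2000.mollifierCoeff P (KMV2000.qhat q ^ Δ') (d₂ * (s₂ * f₂)) : ℂ) *
            ((Real.sqrt ((s₁ * f₁ : ℕ) : ℝ) * Real.sqrt ((s₂ * f₂ : ℕ) : ℝ) : ℝ) : ℂ) else 0))
      (fun f₁ h₁ f₂ h₂ ↦ kloostermanSum (q * r / g) ((s₁ * t₁ / g * (f₁ * f₂) : ℕ) : ZMod (q * r / g))
        ((s₂ * t₂ / g * (h₁ * h₂) : ℕ) : ZMod (q * r / g)))
      (Icc 1 (⌊KMV2000.qhat q ^ Δ'⌋₊ / d₁ / s₁)) (Icc 1 (⌊KMV2000.qhat q ^ Δ'⌋₊ / d₂ / s₂))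
      (q ^ 2 / d₁ / t₁) (q ^ 2 / d₂ / t₂)
    rw [h0, norm_zero, mul_zero]; exact hRHS0
  -- §3 common range facts
  have hYsq : ⌈KMV2000.qhat q ^ (2 + η)⌉₊ ≤ q ^ 2 := ceil_rpow_le_sq h64 hη0 hη1
  have hV' : ⌈KMV2000.qhat q ^ (2 + η)⌉₊ / (d₁ * t₁ * (d₂ * t₂)) ≤ (q ^ 2 / d₁ / t₁) * (q ^ 2 / d₂ / t₂) :=
    hyperbola_le_boxes hd₁1 hd₂1 ht₁1 ht₂ hYsq
  have hNc : s₂ * t₂ / g * (⌈KMV2000.qhat q ^ (2 + η)⌉₊ / (d₁ * t₁ * (d₂ * t₂))) ≤ q * r / g :=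
    dilatedAFE_le_classModulus h64 hΔ2 hη0 hη1 hr hs₂M' hd₁1 hd₂1 ht₁1 ht₂1 hgσ₂ hgpos
  have hσ₁pos : 0 < s₁ * t₁ / g := Nat.div_pos (Nat.le_of_dvd (by positivity) hgσ₁) hgpos
  have hσ₂pos : 0 < s₂ * t₂ / g := Nat.div_pos (Nat.le_of_dvd (by positivity) hgσ₂) hgpos
  have hD₁' : ∀ u ∈ Icc 1 ((⌊KMV2000.qhat q ^ Δ'⌋₊ / d₁ / s₁) * (⌊KMV2000.qhat q ^ Δ'⌋₊ / d₂ / s₂)),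
      (#u.divisors : ℝ) ≤ D₁ := by
    intro u hu
    refine hD₁ u (mem_Icc.mpr ⟨(mem_Icc.mp hu).1, (mem_Icc.mp hu).2.trans ?_⟩)
    exact Nat.mul_le_mul ((Nat.div_le_self _ _).trans (Nat.div_le_self _ _))
      ((Nat.div_le_self _ _).trans (Nat.div_le_self _ _))
  have hD₂' : ∀ v ∈ Icc 1 ((q ^ 2 / d₁ / t₁) * (q ^ 2 / d₂ / t₂)), (#v.divisors : ℝ) ≤ D₂ := by
    intro v hv
    refine hD₂ v (mem_Icc.mpr ⟨(mem_Icc.mp hv).1, (mem_Icc.mp hv).2.trans ?_⟩)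
    exact Nat.mul_le_mul ((Nat.div_le_self _ _).trans (Nat.div_le_self _ _))
      ((Nat.div_le_self _ _).trans (Nat.div_le_self _ _))
  -- `t₁ t₂ ≤ Y ≤ 2 x^{201/100}` (non-empty hyperbola) and `P₀ ≤ 2 x^{403/100}`
  have htt : ((t₁ * t₂ : ℕ) : ℝ) ≤ 2 * KMV2000.qhat q ^ (201 / 100 : ℝ) := by
    have h1 : d₁ * t₁ * (d₂ * t₂) ≤ ⌈KMV2000.qhat q ^ (2 + η)⌉₊ := (Nat.one_le_div_iff hD).mp hV
    have h2 : t₁ * t₂ ≤ d₁ * t₁ * (d₂ * t₂) := by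
      calc t₁ * t₂ = 1 * t₁ * (1 * t₂) := by ring
        _ ≤ d₁ * t₁ * (d₂ * t₂) := Nat.mul_le_mul (Nat.mul_le_mul_right _ hd₁1) (Nat.mul_le_mul_right _ hd₂1)
    have h3 : ((t₁ * t₂ : ℕ) : ℝ) ≤ ((⌈KMV2000.qhat q ^ (2 + η)⌉₊ : ℕ) : ℝ) := by exact_mod_cast h2.trans h1
    refine h3.trans ((natCeil_le_two_mul (Real.one_le_rpow hqh1.le (by linarith))).trans ?_)
    exact mul_le_mul_of_nonneg_left (Real.rpow_le_rpow_of_exponent_le hqh1.le (by linarith)) (by norm_num)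
  have hPhi : P₀ ≤ 2 * KMV2000.qhat q ^ (403 / 100 : ℝ) := by
    have e : P₀ = ((s₁ : ℝ) * s₂) * ((t₁ * t₂ : ℕ) : ℝ) := by rw [hP₀]; push_cast; ring
    rw [e]
    calc ((s₁ : ℝ) * s₂) * ((t₁ * t₂ : ℕ) : ℝ)
        ≤ (KMV2000.qhat q ^ (101 / 100 : ℝ) * KMV2000.qhat q ^ (101 / 100 : ℝ)) * (2 * KMV2000.qhat q ^ (201 / 100 : ℝ)) :=
          mul_le_mul (mul_le_mul hs₁x hs₂x (Nat.cast_nonneg _) (Real.rpow_nonneg hqh0.le _)) htt (Nat.cast_nonneg _)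
            (by positivity)
      _ = 2 * KMV2000.qhat q ^ (403 / 100 : ℝ) := by
          rw [← Real.rpow_add hqh0, ← mul_assoc, mul_comm _ (2 : ℝ), mul_assoc, ← Real.rpow_add hqh0]; norm_num
  have ht₁P : (t₁ : ℝ) ≤ P₀ := by
    rw [hP₀]
    exact_mod_cast (Nat.le_mul_of_pos_left t₁ hs₁1).trans (Nat.le_mul_of_pos_right _ (by positivity))
  have hs₂P : (s₂ : ℝ) ≤ P₀ := by
    rw [hP₀]
    exact_mod_cast (Nat.le_mul_of_pos_right s₂ ht₂1).trans (Nat.le_mul_of_pos_left _ (by positivity))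
  -- §4 the regime dispatch on `t₁ ≶ x^{1/5}`
  by_cases ht₁x : (t₁ : ℝ) ≤ KMV2000.qhat q ^ (1 / 5 : ℝ)
  · -- Pascadi's regime
    -- `q ∤ s₁ t₁`
    have hσ : ¬ q ∣ s₁ * t₁ := by
      intro hdvd
      have hle : (q : ℝ) ≤ (s₁ : ℝ) * t₁ := by exact_mod_cast Nat.le_of_dvd (by positivity) hdvd
      have hq' : (q : ℝ) = 4 * π ^ 2 * KMV2000.qhat q ^ 2 := natCast_eq_four_pi_sq_mul_qhat_sq q
      have hst : (s₁ : ℝ) * t₁ ≤ KMV2000.qhat q ^ (121 / 100 : ℝ) := by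
        calc (s₁ : ℝ) * t₁ ≤ KMV2000.qhat q ^ (101 / 100 : ℝ) * KMV2000.qhat q ^ (1 / 5 : ℝ) :=
              mul_le_mul hs₁x ht₁x (Nat.cast_nonneg _) (Real.rpow_nonneg hqh0.le _)
          _ = KMV2000.qhat q ^ (121 / 100 : ℝ) := by rw [← Real.rpow_add hqh0]; norm_num
      have hlt : KMV2000.qhat q ^ (121 / 100 : ℝ) < (q : ℝ) := by
        rw [hq']
        have h2 : KMV2000.qhat q ^ (121 / 100 : ℝ) < KMV2000.qhat q ^ (2 : ℝ) :=
          Real.rpow_lt_rpow_of_exponent_lt hqh1 (by norm_num)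
        rw [Real.rpow_two] at h2
        have hπ : (1 : ℝ) ≤ 4 * π ^ 2 :=
          (by norm_num : (1 : ℝ) ≤ 4 * 9).trans (mul_le_mul_of_nonneg_left nine_le_pi_sq (by norm_num))
        exact h2.trans_le (le_mul_of_one_le_left (sq_nonneg _) hπ)
      exact absurd (hle.trans hst) (not_le.mpr hlt)
    have hgr : g ∣ r := by rw [hg]; exact (classGcd_dvd_right (r := r) (σ₂ := s₂ * t₂) hq hσ).1
    -- `σ₁' Z₁Z₂ ≤ qr/g`
    have hMc : s₁ * t₁ / g * ((⌊KMV2000.qhat q ^ Δ'⌋₊ / d₁ / s₁) * (⌊KMV2000.qhat q ^ Δ'⌋₊ / d₂ / s₂)) ≤ q * r / g := by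
      rw [Nat.le_div_iff_mul_le hgpos, mul_comm, ← mul_assoc, Nat.mul_div_cancel' hgσ₁]
      have h1 : s₁ * t₁ * ((⌊KMV2000.qhat q ^ Δ'⌋₊ / d₁ / s₁) * (⌊KMV2000.qhat q ^ Δ'⌋₊ / d₂ / s₂)) ≤
          t₁ * (⌊KMV2000.qhat q ^ Δ'⌋₊ * ⌊KMV2000.qhat q ^ Δ'⌋₊) := by
        have hZ₁' : s₁ * (⌊KMV2000.qhat q ^ Δ'⌋₊ / d₁ / s₁) ≤ ⌊KMV2000.qhat q ^ Δ'⌋₊ :=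
          (Nat.mul_div_le _ _).trans (Nat.div_le_self _ _)
        have hZ₂' : ⌊KMV2000.qhat q ^ Δ'⌋₊ / d₂ / s₂ ≤ ⌊KMV2000.qhat q ^ Δ'⌋₊ :=
          (Nat.div_le_self _ _).trans (Nat.div_le_self _ _)
        calc s₁ * t₁ * ((⌊KMV2000.qhat q ^ Δ'⌋₊ / d₁ / s₁) * (⌊KMV2000.qhat q ^ Δ'⌋₊ / d₂ / s₂))
            = t₁ * ((s₁ * (⌊KMV2000.qhat q ^ Δ'⌋₊ / d₁ / s₁)) * (⌊KMV2000.qhat q ^ Δ'⌋₊ / d₂ / s₂)) := by ring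
          _ ≤ t₁ * (⌊KMV2000.qhat q ^ Δ'⌋₊ * ⌊KMV2000.qhat q ^ Δ'⌋₊) :=
              Nat.mul_le_mul_left _ (Nat.mul_le_mul hZ₁' hZ₂')
      refine h1.trans ?_
      have hreal : ((t₁ * (⌊KMV2000.qhat q ^ Δ'⌋₊ * ⌊KMV2000.qhat q ^ Δ'⌋₊) : ℕ) : ℝ) ≤ ((q * r : ℕ) : ℝ) := by
        push_cast
        have hq' : (q : ℝ) = 4 * π ^ 2 * KMV2000.qhat q ^ 2 := natCast_eq_four_pi_sq_mul_qhat_sq q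
        have hL : (t₁ : ℝ) * (((⌊KMV2000.qhat q ^ Δ'⌋₊ : ℕ) : ℝ) * ((⌊KMV2000.qhat q ^ Δ'⌋₊ : ℕ) : ℝ)) ≤
            KMV2000.qhat q ^ (222 / 100 : ℝ) := by
          calc _ ≤ KMV2000.qhat q ^ (1 / 5 : ℝ) * (KMV2000.qhat q ^ (101 / 100 : ℝ) * KMV2000.qhat q ^ (101 / 100 : ℝ)) :=
                mul_le_mul ht₁x (mul_le_mul hMx hMx (Nat.cast_nonneg _) (Real.rpow_nonneg hqh0.le _)) (by positivity)
                  (Real.rpow_nonneg hqh0.le _)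
            _ = KMV2000.qhat q ^ (222 / 100 : ℝ) := by
                rw [← Real.rpow_add hqh0, ← Real.rpow_add hqh0]; norm_num
        have hR : KMV2000.qhat q ^ (222 / 100 : ℝ) ≤ (q : ℝ) * r := by
          rw [hq']
          have h1 : KMV2000.qhat q ^ (222 / 100 : ℝ) ≤ KMV2000.qhat q ^ (2 : ℝ) * KMV2000.qhat q ^ (11 / 10 : ℝ) := by
            rw [← Real.rpow_add hqh0]; exact Real.rpow_le_rpow_of_exponent_le hqh1.le (by norm_num)
          rw [Real.rpow_two] at h1
          have hπ : (1 : ℝ) ≤ 4 * π ^ 2 :=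
            (by norm_num : (1 : ℝ) ≤ 4 * 9).trans (mul_le_mul_of_nonneg_left nine_le_pi_sq (by norm_num))
          calc KMV2000.qhat q ^ (222 / 100 : ℝ) ≤ KMV2000.qhat q ^ 2 * KMV2000.qhat q ^ (11 / 10 : ℝ) := h1
            _ ≤ KMV2000.qhat q ^ 2 * r := mul_le_mul_of_nonneg_left hr.le (sq_nonneg _)
            _ = 1 * (KMV2000.qhat q ^ 2 * r) := (one_mul _).symm
            _ ≤ 4 * π ^ 2 * (KMV2000.qhat q ^ 2 * r) := mul_le_mul_of_nonneg_right hπ (by positivity)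
            _ = 4 * π ^ 2 * KMV2000.qhat q ^ 2 * r := by ring
        exact hL.trans hR
      exact_mod_cast hreal
    have hN1 : 1 ≤ s₂ * t₂ / g * (⌈KMV2000.qhat q ^ (2 + η)⌉₊ / (d₁ * t₁ * (d₂ * t₂))) := Nat.mul_pos hσ₂pos hV
    have hM1 : 1 ≤ s₁ * t₁ / g * ((⌊KMV2000.qhat q ^ Δ'⌋₊ / d₁ / s₁) * (⌊KMV2000.qhat q ^ Δ'⌋₊ / d₂ / s₂)) :=
      Nat.mul_pos hσ₁pos (Nat.mul_pos hZ₁ hZ₂)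
    have hg2P : ((g : ℝ)) ≤ P₀ := by
      rw [hP₀]; exact_mod_cast (Nat.le_of_dvd (by positivity) hgσ₁).trans (Nat.le_mul_of_pos_right _ (by positivity))
    rcases le_total (s₂ * t₂ / g * (⌈KMV2000.qhat q ^ (2 + η)⌉₊ / (d₁ * t₁ * (d₂ * t₂))))
      (s₁ * t₁ / g * ((⌊KMV2000.qhat q ^ Δ'⌋₊ / d₁ / s₁) * (⌊KMV2000.qhat q ^ Δ'⌋₊ / d₂ / s₂))) with hle | hle
    · -- ordering `σ₂'V ≤ σ₁'Z₁Z₂`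
      have main := hA q h64 hq r P B hB Δ' hΔ0 i j K hK0 hK (⌈KMV2000.qhat q ^ (2 + η)⌉₊) d₁ d₂ s₁ t₁ s₂ t₂ g
        hd₁1 hd₂1 hs₁1 hs₂1 ht₁1 ht₂1 hg hσ hN1 hle hMc hV' D₁ D₂ hD₁0 hD₂0 hD₁' hD₂'
      have hbr := (bracket71_class_le (x := KMV2000.qhat q) (Δ' := Δ') (Y := ⌈KMV2000.qhat q ^ (2 + η)⌉₊) hqh0 hq1 hr1
        hd₁1 hd₂1 hs₁1 hs₂1 ht₁1 ht₂1 hgpos hgσ₁ hgσ₂ hgr).trans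
        (bracket71_generic_le h64 hΔ2 hη0 hη1 hr hgpos hd₁1 hd₂1 hs₂1 ht₁1)
      have hbr0 := bracket71_nonneg
        (M := (((s₁ * t₁ / g * ((⌊KMV2000.qhat q ^ Δ'⌋₊ / d₁ / s₁) * (⌊KMV2000.qhat q ^ Δ'⌋₊ / d₂ / s₂)) : ℕ) : ℝ)))
        (N := (((s₂ * t₂ / g * (⌈KMV2000.qhat q ^ (2 + η)⌉₊ / (d₁ * t₁ * (d₂ * t₂))) : ℕ) : ℝ)))
        (c := ((q * r / g : ℕ) : ℝ)) (d := ((r / g : ℕ) : ℝ)) (f := ((r / g : ℕ) : ℝ))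
        (Nat.cast_nonneg _) (Nat.cast_nonneg _) (Nat.cast_nonneg _) (Nat.cast_nonneg _) (Nat.cast_nonneg _)
      have weight := pascadi_weight_le (Δ' := Δ') h64 hη0 hε.le hd₁1 hd₂1 hs₁1 hs₂1 ht₁1 ht₂1 hgpos hgσ₁ hgσ₂ hgc
        (u := (t₁ : ℝ)) (Nat.cast_nonneg _) ht₁P hbr0 hbr
      calc _ ≤ (g : ℝ) * _ := mul_le_mul hφ main (norm_nonneg _) (Nat.cast_nonneg _)
        _ = (CA * Φ) * (Real.sqrt (((⌊KMV2000.qhat q ^ Δ'⌋₊ / d₁ / s₁ : ℕ) : ℝ) * ((⌊KMV2000.qhat q ^ Δ'⌋₊ / d₂ / s₂ : ℕ) : ℝ)) *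
            Real.sqrt ((1 + 2 * Real.log q) * (((⌈KMV2000.qhat q ^ (2 + η)⌉₊ : ℕ) : ℝ) /
              (((d₁ * t₁ : ℕ) : ℝ) * ((d₂ * t₂ : ℕ) : ℝ)))) *
            ((g : ℝ) * ((q * r / g : ℕ) : ℝ) ^ (1 + ε)) *
            (Pascadi2025.bracket71
              ((s₁ * t₁ / g * ((⌊KMV2000.qhat q ^ Δ'⌋₊ / d₁ / s₁) * (⌊KMV2000.qhat q ^ Δ'⌋₊ / d₂ / s₂)) : ℕ) : ℝ)
              ((s₂ * t₂ / g * (⌈KMV2000.qhat q ^ (2 + η)⌉₊ / (d₁ * t₁ * (d₂ * t₂))) : ℕ) : ℝ)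
              ((q * r / g : ℕ) : ℝ) (r / g : ℕ) (r / g : ℕ)) ^ (1 / 6 : ℝ)) := by rw [hΦ]; ring
        _ ≤ (CA * Φ) * (6 * Real.sqrt (1 + 2 * Real.log q) * KMV2000.qhat q ^ (Δ' + 1 + η / 2 - 13 / 600) *
            ((q : ℝ) * r) ^ (1 + ε) / ((d₁ : ℝ) * d₂) * P₀ ^ (-(1 / 12 : ℝ))) :=
            mul_le_mul_of_nonneg_left weight (mul_nonneg hCA0 hΦ0)
        _ = (6 * CA) * T := by rw [hT]; ring
        _ ≤ (6 * (CA + CB) + 4) * T := mul_le_mul_of_nonneg_right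
            ((mul_le_mul_of_nonneg_left (le_add_of_nonneg_right hCB0) (by norm_num)).trans
              (le_add_of_nonneg_right (by norm_num))) hT0
    · -- ordering `σ₁'Z₁Z₂ ≤ σ₂'V`
      have main := hB' q h64 hq r P B hB Δ' hΔ0 i j K hK0 hK (⌈KMV2000.qhat q ^ (2 + η)⌉₊) d₁ d₂ s₁ t₁ s₂ t₂ g
        hd₁1 hd₂1 hs₁1 hs₂1 ht₁1 ht₂1 hg hσ hM1 hle hNc hV' D₁ D₂ hD₁0 hD₂0 hD₁' hD₂'
      have hbr := (bracket71_class_le' (x := KMV2000.qhat q) (Δ' := Δ') (Y := ⌈KMV2000.qhat q ^ (2 + η)⌉₊) hqh0 hq1 hr1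
        hd₁1 hd₂1 hs₁1 hs₂1 ht₁1 ht₂1 hgpos hgσ₁ hgσ₂ hgr).trans
        (bracket71_generic_le' h64 hΔ2 hη0 hη1 hr hgpos hd₁1 hd₂1 hs₂1 ht₁1)
      have hbr0 := bracket71_nonneg
        (N := (((s₁ * t₁ / g * ((⌊KMV2000.qhat q ^ Δ'⌋₊ / d₁ / s₁) * (⌊KMV2000.qhat q ^ Δ'⌋₊ / d₂ / s₂)) : ℕ) : ℝ)))
        (M := (((s₂ * t₂ / g * (⌈KMV2000.qhat q ^ (2 + η)⌉₊ / (d₁ * t₁ * (d₂ * t₂))) : ℕ) : ℝ)))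
        (c := ((q * r / g : ℕ) : ℝ)) (d := ((r / g : ℕ) : ℝ)) (f := ((r / g : ℕ) : ℝ))
        (Nat.cast_nonneg _) (Nat.cast_nonneg _) (Nat.cast_nonneg _) (Nat.cast_nonneg _) (Nat.cast_nonneg _)
      have weight := pascadi_weight_le (Δ' := Δ') h64 hη0 hε.le hd₁1 hd₂1 hs₁1 hs₂1 ht₁1 ht₂1 hgpos hgσ₁ hgσ₂ hgc
        (u := (s₂ : ℝ)) (Nat.cast_nonneg _) hs₂P hbr0 hbr
      calc _ ≤ (g : ℝ) * _ := mul_le_mul hφ main (norm_nonneg _) (Nat.cast_nonneg _)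
        _ = (CB * Φ) * (Real.sqrt (((⌊KMV2000.qhat q ^ Δ'⌋₊ / d₁ / s₁ : ℕ) : ℝ) * ((⌊KMV2000.qhat q ^ Δ'⌋₊ / d₂ / s₂ : ℕ) : ℝ)) *
            Real.sqrt ((1 + 2 * Real.log q) * (((⌈KMV2000.qhat q ^ (2 + η)⌉₊ : ℕ) : ℝ) /
              (((d₁ * t₁ : ℕ) : ℝ) * ((d₂ * t₂ : ℕ) : ℝ)))) *
            ((g : ℝ) * ((q * r / g : ℕ) : ℝ) ^ (1 + ε)) *
            (Pascadi2025.bracket71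
              ((s₂ * t₂ / g * (⌈KMV2000.qhat q ^ (2 + η)⌉₊ / (d₁ * t₁ * (d₂ * t₂))) : ℕ) : ℝ)
              ((s₁ * t₁ / g * ((⌊KMV2000.qhat q ^ Δ'⌋₊ / d₁ / s₁) * (⌊KMV2000.qhat q ^ Δ'⌋₊ / d₂ / s₂)) : ℕ) : ℝ)
              ((q * r / g : ℕ) : ℝ) (r / g : ℕ) (r / g : ℕ)) ^ (1 / 6 : ℝ)) := by rw [hΦ]; ring
        _ ≤ (CB * Φ) * (6 * Real.sqrt (1 + 2 * Real.log q) * KMV2000.qhat q ^ (Δ' + 1 + η / 2 - 13 / 600) *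
            ((q : ℝ) * r) ^ (1 + ε) / ((d₁ : ℝ) * d₂) * P₀ ^ (-(1 / 12 : ℝ))) :=
            mul_le_mul_of_nonneg_left weight (mul_nonneg hCB0 hΦ0)
        _ = (6 * CB) * T := by rw [hT]; ring
        _ ≤ (6 * (CA + CB) + 4) * T := mul_le_mul_of_nonneg_right
            ((mul_le_mul_of_nonneg_left (le_add_of_nonneg_left hCA0) (by norm_num)).trans
              (le_add_of_nonneg_right (by norm_num))) hT0
  · -- the dilated Parseval regime `t₁ > x^{1/5}`
    rw [not_le] at ht₁x
    have hPlo : KMV2000.qhat q ^ (1 / 5 : ℝ) ≤ P₀ := ht₁x.le.trans ht₁P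
    have main := norm_classForm_le_dilatedFourier h64 r hB hΔ0 i j hK0 hK (⌈KMV2000.qhat q ^ (2 + η)⌉₊) g
      hd₁1 hd₂1 hs₁1 hs₂1 ht₁1 ht₂1 hV' hD₁0 hD₂0 hD₁' hD₂'
    -- the multiplicities
    have hc'pos : 0 < q * r / g := Nat.pos_of_ne_zero (NeZero.ne _)
    have hm₂ : ⌈KMV2000.qhat q ^ (2 + η)⌉₊ / (d₁ * t₁ * (d₂ * t₂)) /
        ((q * r / g) / Nat.gcd (s₂ * t₂ / g) (q * r / g)) ≤ 1 := by
      set V := ⌈KMV2000.qhat q ^ (2 + η)⌉₊ / (d₁ * t₁ * (d₂ * t₂)) with hVdef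
      have hg₂pos : 0 < Nat.gcd (s₂ * t₂ / g) (q * r / g) := Nat.gcd_pos_of_pos_right _ hc'pos
      have hg₂le : Nat.gcd (s₂ * t₂ / g) (q * r / g) ≤ s₂ * t₂ / g := Nat.le_of_dvd hσ₂pos (Nat.gcd_dvd_left _ _)
      have hcV : V ≤ (q * r / g) / Nat.gcd (s₂ * t₂ / g) (q * r / g) := by
        rw [Nat.le_div_iff_mul_le hg₂pos]
        calc V * Nat.gcd (s₂ * t₂ / g) (q * r / g) ≤ V * (s₂ * t₂ / g) := Nat.mul_le_mul_left _ hg₂le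
          _ = s₂ * t₂ / g * V := mul_comm _ _
          _ ≤ q * r / g := hNc
      calc V / ((q * r / g) / Nat.gcd (s₂ * t₂ / g) (q * r / g)) ≤ V / V := Nat.div_le_div_left hcV hV
        _ = 1 := Nat.div_self hV
    have hm₁ : ((((⌊KMV2000.qhat q ^ Δ'⌋₊ / d₁ / s₁) * (⌊KMV2000.qhat q ^ Δ'⌋₊ / d₂ / s₂)) /
        ((q * r / g) / Nat.gcd (s₁ * t₁ / g) (q * r / g)) : ℕ) : ℝ) ≤
        KMV2000.qhat q ^ (2 * Δ') * P₀ / ((q : ℝ) * r) := by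
      have hg₁pos : 0 < Nat.gcd (s₁ * t₁ / g) (q * r / g) := Nat.gcd_pos_of_pos_right _ hc'pos
      have hg₁le : (Nat.gcd (s₁ * t₁ / g) (q * r / g) : ℝ) ≤ ((s₁ * t₁ / g : ℕ) : ℝ) := by
        exact_mod_cast Nat.le_of_dvd hσ₁pos (Nat.gcd_dvd_left _ _)
      have hg0' : (g : ℝ) ≠ 0 := by exact_mod_cast hgpos.ne'
      have hc' : ((q * r / g : ℕ) : ℝ) = (q : ℝ) * r / g := by rw [Nat.cast_div hgc hg0']; push_cast; ring
      have hc'0 : (0 : ℝ) < (q : ℝ) * r / g := by rw [← hc']; exact_mod_cast hc'pos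
      have hden : ((((q * r / g) / Nat.gcd (s₁ * t₁ / g) (q * r / g)) : ℕ) : ℝ) =
          ((q : ℝ) * r / g) / (Nat.gcd (s₁ * t₁ / g) (q * r / g) : ℝ) := by
        rw [Nat.cast_div (Nat.gcd_dvd_right _ _) (by exact_mod_cast hg₁pos.ne'), hc']
      have hZ := cast_dilatedMollifier_le (x := KMV2000.qhat q) (Δ' := Δ') hqh0 hd₁1 hd₂1 hs₁1 hs₂1 hgpos hgσ₁
      have h1 := Nat.cast_div_le (α := ℝ)
        (m := (⌊KMV2000.qhat q ^ Δ'⌋₊ / d₁ / s₁) * (⌊KMV2000.qhat q ^ Δ'⌋₊ / d₂ / s₂))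
        (n := (q * r / g) / Nat.gcd (s₁ * t₁ / g) (q * r / g))
      refine h1.trans ?_
      rw [hden, div_div_eq_mul_div, div_le_div_iff₀ hc'0 (by positivity)]
      -- `Z₁Z₂ · g₁ · (q r) ≤ x^{2Δ'} P₀ · (qr/g)`
      have hZg : ((((⌊KMV2000.qhat q ^ Δ'⌋₊ / d₁ / s₁) * (⌊KMV2000.qhat q ^ Δ'⌋₊ / d₂ / s₂) : ℕ)) : ℝ) *
          (Nat.gcd (s₁ * t₁ / g) (q * r / g) : ℝ) ≤ (t₁ : ℝ) * KMV2000.qhat q ^ (2 * Δ') / ((g : ℝ) * d₁ * d₂ * s₂) := by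
        calc _ ≤ ((((⌊KMV2000.qhat q ^ Δ'⌋₊ / d₁ / s₁) * (⌊KMV2000.qhat q ^ Δ'⌋₊ / d₂ / s₂) : ℕ)) : ℝ) *
              ((s₁ * t₁ / g : ℕ) : ℝ) := mul_le_mul_of_nonneg_left hg₁le (Nat.cast_nonneg _)
          _ = ((s₁ * t₁ / g * ((⌊KMV2000.qhat q ^ Δ'⌋₊ / d₁ / s₁) * (⌊KMV2000.qhat q ^ Δ'⌋₊ / d₂ / s₂)) : ℕ) : ℝ) := by
              push_cast; ring
          _ ≤ _ := hZ
      have ht₁P' : (t₁ : ℝ) / ((g : ℝ) * d₁ * d₂ * s₂) ≤ P₀ / g := by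
        rw [div_le_div_iff₀ (by positivity) (by positivity)]
        have h1 : (1 : ℝ) ≤ (d₁ : ℝ) * d₂ * s₂ := by
          exact_mod_cast Nat.one_le_iff_ne_zero.mpr (by positivity : d₁ * d₂ * s₂ ≠ 0)
        calc (t₁ : ℝ) * g = t₁ * 1 * g := by ring
          _ ≤ P₀ * ((d₁ : ℝ) * d₂ * s₂) * g := by gcongr
          _ = P₀ * ((g : ℝ) * d₁ * d₂ * s₂) := by ring
      calc ((((⌊KMV2000.qhat q ^ Δ'⌋₊ / d₁ / s₁) * (⌊KMV2000.qhat q ^ Δ'⌋₊ / d₂ / s₂) : ℕ)) : ℝ) *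
            (Nat.gcd (s₁ * t₁ / g) (q * r / g) : ℝ) * ((q : ℝ) * r)
          ≤ ((t₁ : ℝ) * KMV2000.qhat q ^ (2 * Δ') / ((g : ℝ) * d₁ * d₂ * s₂)) * ((q : ℝ) * r) :=
            mul_le_mul_of_nonneg_right hZg (by positivity)
        _ = KMV2000.qhat q ^ (2 * Δ') * ((t₁ : ℝ) / ((g : ℝ) * d₁ * d₂ * s₂)) * ((q : ℝ) * r) := by ring
        _ ≤ KMV2000.qhat q ^ (2 * Δ') * (P₀ / g) * ((q : ℝ) * r) := by gcongr
        _ = KMV2000.qhat q ^ (2 * Δ') * P₀ * ((q : ℝ) * r / g) := by ring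
    have weight := fourier_weight_le (Δ' := Δ') h64 hΔ2 hη0 hε.le hr hd₁1 hd₂1 hs₁1 hs₂1 ht₁1 ht₂1 hgpos hgc hm₁ hm₂ hPlo hPhi
    calc _ ≤ (g : ℝ) * _ := mul_le_mul hφ main (norm_nonneg _) (Nat.cast_nonneg _)
      _ = Φ * ((g : ℝ) * ((q * r / g : ℕ) : ℝ) *
          Real.sqrt ((((⌊KMV2000.qhat q ^ Δ'⌋₊ / d₁ / s₁) * (⌊KMV2000.qhat q ^ Δ'⌋₊ / d₂ / s₂)) /
            ((q * r / g) / Nat.gcd (s₁ * t₁ / g) (q * r / g)) + 1 : ℕ) : ℝ) *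
          Real.sqrt (((⌈KMV2000.qhat q ^ (2 + η)⌉₊ / (d₁ * t₁ * (d₂ * t₂))) /
            ((q * r / g) / Nat.gcd (s₂ * t₂ / g) (q * r / g)) + 1 : ℕ) : ℝ) *
          Real.sqrt (((⌊KMV2000.qhat q ^ Δ'⌋₊ / d₁ / s₁ : ℕ) : ℝ) * ((⌊KMV2000.qhat q ^ Δ'⌋₊ / d₂ / s₂ : ℕ) : ℝ)) *
          Real.sqrt ((1 + 2 * Real.log q) * (((⌈KMV2000.qhat q ^ (2 + η)⌉₊ : ℕ) : ℝ) /
            (((d₁ * t₁ : ℕ) : ℝ) * ((d₂ * t₂ : ℕ) : ℝ))))) := by rw [hΦ]; ring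
      _ ≤ Φ * (4 * Real.sqrt (1 + 2 * Real.log q) * KMV2000.qhat q ^ (Δ' + 1 + η / 2 - 13 / 600) *
          ((q : ℝ) * r) ^ (1 + ε) / ((d₁ : ℝ) * d₂) * P₀ ^ (-(1 / 12 : ℝ))) := mul_le_mul_of_nonneg_left weight hΦ0
      _ = 4 * T := by rw [hT]; ring
      _ ≤ (6 * (CA + CB) + 4) * T :=
          mul_le_mul_of_nonneg_right (le_add_of_nonneg_left (by positivity)) hT0

end Summit.Parity.GeneralizedHardyLittlewood.Theorems.MomentsBeyondDiagonal.Layers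

end
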